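import Mathlib
import HarnessLib
import Summits.HubbardSuperconductivity.HubbardSuperconductivity.Theorems.KLProgrammeC4aPathJets
import Summits.HubbardSuperconductivity.HubbardSuperconductivity.Theorems.KLProgrammeC4aLevelDensityRadialVertex

/-!
# Route `KLProgramme` — crux C4a, (L3) RIGIDITY of the pair paths: the jets of the pair-sum path VANISH at the Cooper configuration to every
# order and are LINEARLY small near it — `‖∂ⁱ_t S_{ρ,ϑ,θ}(0)‖ ≤ (radial row)·|ρ| + msD A₃ A₄ (i+1)·|ϑ − π|` (`i ≤ 3`), uniformly in `θ`;
# the particle–hole twin around the forward configuration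

Cell `gate-hubbard-kl`, lane hubbard-kl-c4a-1 (g5); helper for stub (C) `stub_twoLeg_curvature` of the engine-flow child `KLRegimeEngineV17F2`
(stmt-HubbardSuperconductivity-20437); memo HOME/hubbard-kl-c4a-1/C4A-PLAN.md §10 (co-move every loop momentum), §22.5.  WHY THIS FILE: the bridge
`coMovingJetsL1_pairSum` (`…C4aCoMovingBridge`) turns θ-uniform majorants `Mb k (ρ,ϑ)` of the bubble's Fréchet jets along the pair-sum path and
`Ds i (ρ,ϑ)` of the PATH's jets into Bell dominators `Mb k · Π Ds_{iₗ}` (`k` factors, `Σ iₗ = j`).  For the scale-resolved pp bubble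
`Mb k ≍ max(‖S(0)‖, Λ_n)^{−k}` near the Cooper point `(ρ,ϑ) = (0,π)`, so CONSTANT path tables (`…C4aPathJets`: `Ds i = 2·msD A₃ A₄ i`) lose `k` powers
of the scale; the cure is FST II's inner co-moving gain in its sharpest form: the pair-sum path is RIGID — `S_{0,π,θ} ≡ 0` (`pairSumPath_cooper`),
hence EVERY jet vanishes there, and near it `‖∂ⁱ_t S(0)‖ ≲ |ρ| + |ϑ − π| ≍ ‖S(0)‖`: each Bell monomial is `O(1)`, the `ϑ`-integral is `n`-free.

* §1 `levelPoint_add_two_pi`, `iteratedDeriv_levelPoint_add_pi` (`γ_ρ⁽ⁱ⁾(s+π) = −γ_ρ⁽ⁱ⁾(s)`), `iteratedDeriv_levelPoint_add_two_pi` (periodicity),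
  **`iteratedDeriv_pairSumPath_zero_eq_sub`**: `∂ⁱS_{ρ,ϑ,θ}(0) = [γ_ρ⁽ⁱ⁾(ϑ+θ) − γ₀⁽ⁱ⁾(ϑ+θ)] + [γ₀⁽ⁱ⁾(ϑ+θ) − γ₀⁽ⁱ⁾(π+θ)]` (radial + angular displacement),
  `iteratedDeriv_pairDiffPath_zero_eq_sub` (ph twin around `ϑ = 0`);
* §2 **`norm_iteratedDeriv_levelPoint_sub_le_angle`** — the angular mean-value step on one level curve: `‖γ_ρ⁽ⁱ⁾(s) − γ_ρ⁽ⁱ⁾(s′)‖ ≤ msD A₃ A₄ (i+1)·|s − s′|`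
  (`i ≤ 3`, the table of `…C4aPathJets.norm_iteratedDeriv_levelPoint_le` one order up);
* §3 **`norm_iteratedDeriv_pairSumPath_le_rigid`** (`i ≤ 3`): given the RADIAL ROW `‖γ_ρ⁽ⁱ⁾(s) − γ₀⁽ⁱ⁾(s)‖ ≤ Lr` (a named input for `i ≥ 1` — the
  level-Lipschitz size of the chart's angular jets, Jacobian-certificate lineage; DISCHARGED here at `i = 0` by k3c3-p3's `norm_levelPoint_sub_levelPoint_le`:
  **`norm_pairSumPath_zero_le`**, `‖S(0)‖ ≤ |ρ|/(Dt_min − 2A) + msD A₃ A₄ 1·|ϑ − π|` — the UPPER comparability of `‖k + q‖` with the chart distance to the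
  Cooper point), `‖∂ⁱS(0)‖ ≤ Lr + msD A₃ A₄ (i+1)·|ϑ − π|`; the ph-exchange twins `norm_iteratedDeriv_pairDiffPath_le_rigid` (`|ϑ|`) / `…_rigid'` (`|ϑ − 2π|`,
  periodicity) and `norm_pairDiffPath_zero_le` / `…_le'`.

Proved calculus on the tree's objects (band/tube hypotheses keyed by the frame's sizes exactly as `…C4aPathJets`); nothing about the Hubbard model's sizes;
nothing asserts superconductivity.  References: FST II CPAM 51 (1998) §3 Thm 3.5 (inner co-moving volume gain); BGM 2006 §2.4 Lemma 2.1 (2.40)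
[cite: BenfattoGiulianiMastropietro2006].
-/

noncomputable section

namespace Summit.HubbardSuperconductivity.HubbardSuperconductivity.Theorems.C4a

set_option linter.dupNamespace false -- summit = problem name (single-conjunct summit), D-0017

open Real Set MeasureTheory Finset
open scoped ContDiff
open Literature.MathematicalPhysics.QuantumLattice Literature.MathematicalPhysics.QuantumLattice.BandSectorCounting Literature.Probability.LatticeModels
open Summit.HubbardSuperconductivity.HubbardSuperconductivity.Theorems.KLRegimeSplit
open Summit.HubbardSuperconductivity.HubbardSuperconductivity.Theorems.DispersionFlow
open Summit.HubbardSuperconductivity.HubbardSuperconductivity.Theorems.PerturbedFermiCurve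

/-! ## §1 Half-turn antisymmetry, periodicity, and the radial + angular decomposition of the path jets -/

/-- The level curves are `2π`-periodic in the angle. -/
theorem levelPoint_add_two_pi (μ : ℝ) (K : TrigPolyC4v) (ρ s : ℝ) : levelPoint μ K ρ (s + 2 * π) = levelPoint μ K ρ s := by
  simp only [levelPoint, klFermiPoint_periodic (μ + ρ) K s]

/-- **Half-turn antisymmetry of the curve jets**: `γ_ρ⁽ⁱ⁾(s + π) = −γ_ρ⁽ⁱ⁾(s)`. -/
theorem iteratedDeriv_levelPoint_add_pi (μ : ℝ) (K : TrigPolyC4v) (ρ : ℝ) (i : ℕ) (s : ℝ) :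
    iteratedDeriv i (levelPoint μ K ρ) (s + π) = -iteratedDeriv i (levelPoint μ K ρ) s := by
  have hfun : (fun z : ℝ => levelPoint μ K ρ (z + π)) = fun z => -levelPoint μ K ρ z := funext fun z => levelPoint_add_pi μ K ρ z
  have h := congrFun (iteratedDeriv_comp_add_const i (levelPoint μ K ρ) π) s
  rw [← h, hfun, iteratedDeriv_fun_neg]

/-- **Periodicity of the curve jets**: `γ_ρ⁽ⁱ⁾(s + 2π) = γ_ρ⁽ⁱ⁾(s)`. -/
theorem iteratedDeriv_levelPoint_add_two_pi (μ : ℝ) (K : TrigPolyC4v) (ρ : ℝ) (i : ℕ) (s : ℝ) :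
    iteratedDeriv i (levelPoint μ K ρ) (s + 2 * π) = iteratedDeriv i (levelPoint μ K ρ) s := by
  have hfun : (fun z : ℝ => levelPoint μ K ρ (z + 2 * π)) = fun z => levelPoint μ K ρ z := funext fun z => levelPoint_add_two_pi μ K ρ z
  have h := congrFun (iteratedDeriv_comp_add_const i (levelPoint μ K ρ) (2 * π)) s
  rw [← h, hfun]

section Sizes

variable {K : TrigPolyC4v} {A : ℝ} (hA : ∀ p : Momentum, ∀ j ≤ 2, ‖iteratedFDeriv ℝ j (frameShift K) p‖ ≤ A) (hA20 : A ≤ 1 / 20)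
  (hd : klCurveD ≤ (bandBounds (show (-4 : ℝ) < -1.1 by norm_num) (show (-1.1 : ℝ) ≤ -0.1 by norm_num)
    (show (-0.1 : ℝ) < 0 by norm_num)).Dtmin - 2 * A)
  {μ r : ℝ} (hr : 0 < r) (hlo : (-1.1 : ℝ) < μ - r - A) (hhi : μ + r + A < -0.1)
  {A₃ A₄ : ℝ} (hA₃ : ∀ p : Momentum, ‖iteratedFDeriv ℝ 3 (frameShift K) p‖ ≤ A₃)
  (hA₄ : ∀ p : Momentum, ‖iteratedFDeriv ℝ 4 (frameShift K) p‖ ≤ A₄)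
include hA hA20 hd hr hlo hhi hA₃ hA₄

omit hA20 hA₃ hA₄ in
/-- **Radial + angular decomposition of the pair-sum path's jets**:
`∂ⁱS_{ρ,ϑ,θ}(0) = [γ_ρ⁽ⁱ⁾(ϑ+θ) − γ₀⁽ⁱ⁾(ϑ+θ)] + [γ₀⁽ⁱ⁾(ϑ+θ) − γ₀⁽ⁱ⁾(π+θ)]` (`γ₀⁽ⁱ⁾(θ) = −γ₀⁽ⁱ⁾(θ+π)`). -/
theorem iteratedDeriv_pairSumPath_zero_eq_sub {ρ : ℝ} (hρ : |ρ| < r) (ϑ θ : ℝ) (i : ℕ) :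
    iteratedDeriv i (pairSumPath μ K ρ ϑ θ) 0 =
      (iteratedDeriv i (levelPoint μ K ρ) (ϑ + θ) - iteratedDeriv i (levelPoint μ K 0) (ϑ + θ)) +
        (iteratedDeriv i (levelPoint μ K 0) (ϑ + θ) - iteratedDeriv i (levelPoint μ K 0) (π + θ)) := by
  rw [iteratedDeriv_pairSumPath_zero hA hd hr hlo hhi hρ, show π + θ = θ + π by ring, iteratedDeriv_levelPoint_add_pi]
  abel

omit hA20 hA₃ hA₄ in
/-- **Radial + angular decomposition of the pair-difference path's jets** (around the forward configuration `ϑ = 0`):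
`∂ⁱD_{ρ,ϑ,θ}(0) = [γ₀⁽ⁱ⁾(θ) − γ₀⁽ⁱ⁾(ϑ+θ)] + [γ₀⁽ⁱ⁾(ϑ+θ) − γ_ρ⁽ⁱ⁾(ϑ+θ)]`. -/
theorem iteratedDeriv_pairDiffPath_zero_eq_sub {ρ : ℝ} (hρ : |ρ| < r) (ϑ θ : ℝ) (i : ℕ) :
    iteratedDeriv i (pairDiffPath μ K ρ ϑ θ) 0 =
      (iteratedDeriv i (levelPoint μ K 0) θ - iteratedDeriv i (levelPoint μ K 0) (ϑ + θ)) +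
        (iteratedDeriv i (levelPoint μ K 0) (ϑ + θ) - iteratedDeriv i (levelPoint μ K ρ) (ϑ + θ)) := by
  rw [iteratedDeriv_pairDiffPath_zero hA hd hr hlo hhi hρ]
  abel

/-! ## §2 The angular mean-value step on one level curve -/

omit hr in
/-- **Angular displacement of a curve jet**: for `|ρ| < r` and `i ≤ 3`, `‖γ_ρ⁽ⁱ⁾(s) − γ_ρ⁽ⁱ⁾(s′)‖ ≤ msD A₃ A₄ (i+1)·|s − s′|`
(mean value theorem; `γ_ρ⁽ⁱ⁾` is differentiable with derivative `γ_ρ⁽ⁱ⁺¹⁾`, bounded by the table one order up). -/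
theorem norm_iteratedDeriv_levelPoint_sub_le_angle {ρ : ℝ} (hρ : |ρ| < r) {i : ℕ} (hi : i ≤ 3) (s s' : ℝ) :
    ‖iteratedDeriv i (levelPoint μ K ρ) s - iteratedDeriv i (levelPoint μ K ρ) s'‖ ≤ msD A₃ A₄ (i + 1) * |s - s'| := by
  have hC : ContDiff ℝ ↑(i + 1) (levelPoint μ K ρ) := contDiff_levelPoint_of_sizes hA hd hlo hhi hρ (i + 1)
  have hdiff : Differentiable ℝ (iteratedDeriv i (levelPoint μ K ρ)) :=
    hC.differentiable_iteratedDeriv i (by exact_mod_cast Nat.lt_succ_self i)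
  have hbound : ∀ x ∈ (univ : Set ℝ), ‖deriv (iteratedDeriv i (levelPoint μ K ρ)) x‖ ≤ msD A₃ A₄ (i + 1) := by
    intro x _
    rw [← iteratedDeriv_succ]
    exact norm_iteratedDeriv_levelPoint_le hA hA20 hd hlo hhi hA₃ hA₄ hρ (Nat.succ_le_succ (Nat.zero_le i)) (by omega) x
  have h := (convex_univ (𝕜 := ℝ) (E := ℝ)).norm_image_sub_le_of_norm_deriv_le (fun x _ => hdiff x) hbound (mem_univ s') (mem_univ s)
  rwa [Real.norm_eq_abs] at h

/-! ## §3 Rigidity bounds -/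

/-- **RIGIDITY of the pair-sum path (`i ≤ 3`)**: if the radial row of the `i`-th curve jet is `‖γ_ρ⁽ⁱ⁾(s) − γ₀⁽ⁱ⁾(s)‖ ≤ Lr` (all `s`), then
`‖∂ⁱ_t S_{ρ,ϑ,θ}(0)‖ ≤ Lr + msD A₃ A₄ (i+1)·|ϑ − π|` — uniformly in the base angle `θ`.  At the Cooper configuration (`ρ = 0`, `ϑ = π`, `Lr = 0`) the
jet vanishes. [cite: BenfattoGiulianiMastropietro2006, §2.4 (2.40)] -/
theorem norm_iteratedDeriv_pairSumPath_le_rigid {ρ : ℝ} (hρ : |ρ| < r) {i : ℕ} (hi : i ≤ 3) {Lr : ℝ}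
    (hLr : ∀ s : ℝ, ‖iteratedDeriv i (levelPoint μ K ρ) s - iteratedDeriv i (levelPoint μ K 0) s‖ ≤ Lr) (ϑ θ : ℝ) :
    ‖iteratedDeriv i (pairSumPath μ K ρ ϑ θ) 0‖ ≤ Lr + msD A₃ A₄ (i + 1) * |ϑ - π| := by
  have h0 : |(0 : ℝ)| < r := by simpa using hr
  rw [iteratedDeriv_pairSumPath_zero_eq_sub hA hd hr hlo hhi hρ]
  refine (norm_add_le _ _).trans (add_le_add (hLr _) ?_)
  have h := norm_iteratedDeriv_levelPoint_sub_le_angle hA hA20 hd hlo hhi hA₃ hA₄ h0 hi (ϑ + θ) (π + θ)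
  rwa [show ϑ + θ - (π + θ) = ϑ - π by ring] at h

/-- **UPPER COMPARABILITY at order zero, radial row discharged**: `‖S_{ρ,ϑ,θ}(0)‖ = ‖Φ(0,θ) + Φ(ρ,ϑ+θ)‖ ≤ |ρ|/(Dt_min − 2A) + msD A₃ A₄ 1·|ϑ − π|`
(k3c3-p3's `norm_levelPoint_sub_levelPoint_le` for the radial displacement). -/
theorem norm_pairSumPath_zero_le {ρ : ℝ} (hρ : |ρ| < r) (ϑ θ : ℝ) :
    ‖pairSumPath μ K ρ ϑ θ 0‖ ≤
      |ρ| / ((bandBounds (show (-4 : ℝ) < -1.1 by norm_num) (show (-1.1 : ℝ) ≤ -0.1 by norm_num) (show (-0.1 : ℝ) < 0 by norm_num)).Dtmin -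
          2 * A) + msD A₃ A₄ 1 * |ϑ - π| := by
  have hADt : 2 * A < (bandBounds (show (-4 : ℝ) < -1.1 by norm_num) (show (-1.1 : ℝ) ≤ -0.1 by norm_num)
      (show (-0.1 : ℝ) < 0 by norm_num)).Dtmin := by have := klCurveD_pos; linarith
  have hρI : ρ ∈ Ioo (-r) r := ⟨(abs_lt.1 hρ).1, (abs_lt.1 hρ).2⟩
  have h0I : (0 : ℝ) ∈ Ioo (-r) r := ⟨by linarith, hr⟩
  have hLr : ∀ s : ℝ, ‖iteratedDeriv 0 (levelPoint μ K ρ) s - iteratedDeriv 0 (levelPoint μ K 0) s‖ ≤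
      |ρ| / ((bandBounds (show (-4 : ℝ) < -1.1 by norm_num) (show (-1.1 : ℝ) ≤ -0.1 by norm_num) (show (-0.1 : ℝ) < 0 by norm_num)).Dtmin -
        2 * A) := fun s => by
    simpa only [iteratedDeriv_zero, sub_zero] using norm_levelPoint_sub_levelPoint_le (bandBounds _ _ _) hA hADt hlo hhi hρI h0I s
  simpa only [iteratedDeriv_zero] using norm_iteratedDeriv_pairSumPath_le_rigid hA hA20 hd hr hlo hhi hA₃ hA₄ hρ (i := 0) (by norm_num) hLr ϑ θ

/-- **RIGIDITY of the pair-difference path around the forward configuration (`i ≤ 3`)**: with the radial row `‖γ_ρ⁽ⁱ⁾(s) − γ₀⁽ⁱ⁾(s)‖ ≤ Lr`,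
`‖∂ⁱ_t D_{ρ,ϑ,θ}(0)‖ ≤ Lr + msD A₃ A₄ (i+1)·|ϑ|`. -/
theorem norm_iteratedDeriv_pairDiffPath_le_rigid {ρ : ℝ} (hρ : |ρ| < r) {i : ℕ} (hi : i ≤ 3) {Lr : ℝ}
    (hLr : ∀ s : ℝ, ‖iteratedDeriv i (levelPoint μ K ρ) s - iteratedDeriv i (levelPoint μ K 0) s‖ ≤ Lr) (ϑ θ : ℝ) :
    ‖iteratedDeriv i (pairDiffPath μ K ρ ϑ θ) 0‖ ≤ Lr + msD A₃ A₄ (i + 1) * |ϑ| := by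
  have h0 : |(0 : ℝ)| < r := by simpa using hr
  rw [iteratedDeriv_pairDiffPath_zero_eq_sub hA hd hr hlo hhi hρ, add_comm Lr]
  refine (norm_add_le _ _).trans (add_le_add ?_ ?_)
  · have h := norm_iteratedDeriv_levelPoint_sub_le_angle hA hA20 hd hlo hhi hA₃ hA₄ h0 hi θ (ϑ + θ)
    rwa [show θ - (ϑ + θ) = -ϑ by ring, abs_neg] at h
  · rw [← norm_neg, neg_sub]; exact hLr _

/-- **RIGIDITY of the pair-difference path near `ϑ = 2π`** (the forward configuration seen from the other end of `(0, 2π]`, periodicity):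
`‖∂ⁱ_t D_{ρ,ϑ,θ}(0)‖ ≤ Lr + msD A₃ A₄ (i+1)·|ϑ − 2π|`. -/
theorem norm_iteratedDeriv_pairDiffPath_le_rigid' {ρ : ℝ} (hρ : |ρ| < r) {i : ℕ} (hi : i ≤ 3) {Lr : ℝ}
    (hLr : ∀ s : ℝ, ‖iteratedDeriv i (levelPoint μ K ρ) s - iteratedDeriv i (levelPoint μ K 0) s‖ ≤ Lr) (ϑ θ : ℝ) :
    ‖iteratedDeriv i (pairDiffPath μ K ρ ϑ θ) 0‖ ≤ Lr + msD A₃ A₄ (i + 1) * |ϑ - 2 * π| := by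
  have h0 : |(0 : ℝ)| < r := by simpa using hr
  rw [iteratedDeriv_pairDiffPath_zero_eq_sub hA hd hr hlo hhi hρ, add_comm Lr]
  refine (norm_add_le _ _).trans (add_le_add ?_ ?_)
  · have h := norm_iteratedDeriv_levelPoint_sub_le_angle hA hA20 hd hlo hhi hA₃ hA₄ h0 hi (θ + 2 * π) (ϑ + θ)
    rw [iteratedDeriv_levelPoint_add_two_pi, show θ + 2 * π - (ϑ + θ) = -(ϑ - 2 * π) by ring, abs_neg] at h
    exact h
  · rw [← norm_neg, neg_sub]; exact hLr _

/-- **UPPER COMPARABILITY at order zero for the pair-difference path**: `‖D_{ρ,ϑ,θ}(0)‖ ≤ |ρ|/(Dt_min − 2A) + msD A₃ A₄ 1·|ϑ|`. -/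
theorem norm_pairDiffPath_zero_le {ρ : ℝ} (hρ : |ρ| < r) (ϑ θ : ℝ) :
    ‖pairDiffPath μ K ρ ϑ θ 0‖ ≤
      |ρ| / ((bandBounds (show (-4 : ℝ) < -1.1 by norm_num) (show (-1.1 : ℝ) ≤ -0.1 by norm_num) (show (-0.1 : ℝ) < 0 by norm_num)).Dtmin -
          2 * A) + msD A₃ A₄ 1 * |ϑ| := by
  have hADt : 2 * A < (bandBounds (show (-4 : ℝ) < -1.1 by norm_num) (show (-1.1 : ℝ) ≤ -0.1 by norm_num)
      (show (-0.1 : ℝ) < 0 by norm_num)).Dtmin := by have := klCurveD_pos; linarith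
  have hρI : ρ ∈ Ioo (-r) r := ⟨(abs_lt.1 hρ).1, (abs_lt.1 hρ).2⟩
  have h0I : (0 : ℝ) ∈ Ioo (-r) r := ⟨by linarith, hr⟩
  have hLr : ∀ s : ℝ, ‖iteratedDeriv 0 (levelPoint μ K ρ) s - iteratedDeriv 0 (levelPoint μ K 0) s‖ ≤
      |ρ| / ((bandBounds (show (-4 : ℝ) < -1.1 by norm_num) (show (-1.1 : ℝ) ≤ -0.1 by norm_num) (show (-0.1 : ℝ) < 0 by norm_num)).Dtmin -
        2 * A) := fun s => by
    simpa only [iteratedDeriv_zero, sub_zero] using norm_levelPoint_sub_levelPoint_le (bandBounds _ _ _) hA hADt hlo hhi hρI h0I s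
  simpa only [iteratedDeriv_zero] using norm_iteratedDeriv_pairDiffPath_le_rigid hA hA20 hd hr hlo hhi hA₃ hA₄ hρ (i := 0) (by norm_num) hLr ϑ θ

/-- **UPPER COMPARABILITY at order zero for the pair-difference path, near `ϑ = 2π`**: `‖D_{ρ,ϑ,θ}(0)‖ ≤ |ρ|/(Dt_min − 2A) + msD A₃ A₄ 1·|ϑ − 2π|`. -/
theorem norm_pairDiffPath_zero_le' {ρ : ℝ} (hρ : |ρ| < r) (ϑ θ : ℝ) :
    ‖pairDiffPath μ K ρ ϑ θ 0‖ ≤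
      |ρ| / ((bandBounds (show (-4 : ℝ) < -1.1 by norm_num) (show (-1.1 : ℝ) ≤ -0.1 by norm_num) (show (-0.1 : ℝ) < 0 by norm_num)).Dtmin -
          2 * A) + msD A₃ A₄ 1 * |ϑ - 2 * π| := by
  have hADt : 2 * A < (bandBounds (show (-4 : ℝ) < -1.1 by norm_num) (show (-1.1 : ℝ) ≤ -0.1 by norm_num)
      (show (-0.1 : ℝ) < 0 by norm_num)).Dtmin := by have := klCurveD_pos; linarith
  have hρI : ρ ∈ Ioo (-r) r := ⟨(abs_lt.1 hρ).1, (abs_lt.1 hρ).2⟩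
  have h0I : (0 : ℝ) ∈ Ioo (-r) r := ⟨by linarith, hr⟩
  have hLr : ∀ s : ℝ, ‖iteratedDeriv 0 (levelPoint μ K ρ) s - iteratedDeriv 0 (levelPoint μ K 0) s‖ ≤
      |ρ| / ((bandBounds (show (-4 : ℝ) < -1.1 by norm_num) (show (-1.1 : ℝ) ≤ -0.1 by norm_num) (show (-0.1 : ℝ) < 0 by norm_num)).Dtmin -
        2 * A) := fun s => by
    simpa only [iteratedDeriv_zero, sub_zero] using norm_levelPoint_sub_levelPoint_le (bandBounds _ _ _) hA hADt hlo hhi hρI h0I s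
  simpa only [iteratedDeriv_zero] using norm_iteratedDeriv_pairDiffPath_le_rigid' hA hA20 hd hr hlo hhi hA₃ hA₄ hρ (i := 0) (by norm_num) hLr ϑ θ

end Sizes

end Summit.HubbardSuperconductivity.HubbardSuperconductivity.Theorems.C4a

end
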